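import Mathlib
import Literature.RepresentationTheory.FiniteGroups.IrreducibleCharacters

/-!
# Stub `stub_shareUniversality` of crux `stmt-MatrixMultiplication-7610` (`GradedDesignFamily`) — Mathlib-API proof

Route `MatrixMultiplication/LevelGradedCohnUmans`, crux
`Summit.MatrixMultiplication.MatrixMultiplication.Theses.LevelGradedCohnUmans.GradedDesignFamily`,
registered stub `stub_shareUniversality` (siege `k = 13`, variation "Mathlib API route").

**Statement.** Fix a filling fraction `c > 0`.  Suppose that for every ratio `R` there are a finite
group `G`, a bi-invariant test space `J ≤ ℂ^G`, the wall `B₂ = Σ_{χ ∈ Irr G ∩ J} χ(1)² > 0`, and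
`t ≥ 1` simultaneously `J`-separated triples `(X_i, Y_i, Z_i)` with volumes
`|X_i| |Y_i| |Z_i| ≥ c (B₂/t)^{3/2}` and `R t χ(1)² ≤ B₂` for every irreducible `χ ∈ J`.  Then for
every `ε > 0` some member of the family is a graded simultaneous design at exponent `2 + ε`:
`Σ_{χ ∈ Irr G ∩ J} χ(1)^{2+ε} < Σ_i (|X_i| |Y_i| |Z_i|)^{(2+ε)/3}`.

**Proof (power-mean bookkeeping, done with the Mathlib API).**
* the ratio `R` is produced by a filter argument: `R ↦ R^{-ε/2}` tends to `0` at `+∞`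
  (`tendsto_rpow_neg_atTop`), so eventually `R^{-ε/2} < c^{(2+ε)/3}` and `R > 0`;
* the `finsum` over `Irr G ∩ J` is a `Finset.sum` (`irrChars_finite_holds`,
  `finsum_mem_eq_finite_toFinset_sum`), and every degree `χ(1)` is a natural number
  (`IsIrrChar.exists_apply_one`), hence `≥ 0`;
* budget: termwise `χ(1)^{2+ε} = χ(1)² (χ(1)²)^{ε/2} ≤ χ(1)² (B₂/(tR))^{ε/2}`
  (`Real.rpow_add'`, `Real.rpow_natCast_mul`, `Real.rpow_le_rpow`), summed with `Finset.sum_le_sum`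
  and `Finset.sum_mul`: budget `≤ B₂ (B₂/t)^{ε/2} R^{-ε/2}`;
* value: termwise `(c (B₂/t)^{3/2})^{(2+ε)/3} ≤ (|X_i| |Y_i| |Z_i|)^{(2+ε)/3}`, summed with
  `Finset.card_nsmul_le_sum`: value `≥ t c^{(2+ε)/3} (B₂/t)^{1+ε/2} = c^{(2+ε)/3} B₂ (B₂/t)^{ε/2}`;
* compare with `mul_lt_mul_of_pos_left` and the choice of `R`.
[cite: CohnKleinbergSzegedyUmans2005, Thm. 5.5]
-/

noncomputable section

set_option linter.dupNamespace false

open scoped BigOperators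
open Filter Literature.RepresentationTheory.FiniteGroups

namespace Summit.MatrixMultiplication.MatrixMultiplication.Theorems.GradedDesignFamily.MathlibRoute

/-- **Choice of the ratio by a limit argument.**  For `c > 0` and `ε > 0`, all sufficiently large
ratios `R` (eventually along `Filter.atTop`) satisfy `0 < R` and `R^{-ε/2} < c^{(2+ε)/3}`, because
`R^{-ε/2} → 0` as `R → +∞` (`tendsto_rpow_neg_atTop`). -/
theorem eventually_ratio {c ε : ℝ} (hc : 0 < c) (hε : 0 < ε) :
    ∀ᶠ R : ℝ in atTop, 0 < R ∧ R ^ (-(ε / 2)) < c ^ ((2 + ε) / 3) :=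
  (eventually_gt_atTop (0 : ℝ)).and <|
    (tendsto_rpow_neg_atTop (half_pos hε)).eventually
      (eventually_lt_nhds (Real.rpow_pos_of_pos hc _))

/-- **Termwise budget bound.**  If `0 ≤ d`, `d² ≤ M` and `0 ≤ e`, then `d^{2+e} ≤ d² · M^{e/2}`:
write `d^{2+e} = d² · (d²)^{e/2}` (`Real.rpow_add'`, `Real.rpow_natCast_mul`) and use the
monotonicity of `x ↦ x^{e/2}` (`Real.rpow_le_rpow`). -/
theorem rpow_two_add_le {d M e : ℝ} (hd : 0 ≤ d) (hM : d ^ 2 ≤ M) (he : 0 ≤ e) :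
    d ^ (2 + e) ≤ d ^ 2 * M ^ (e / 2) := by
  have h2e : (2 : ℝ) + e ≠ 0 := by positivity
  have hsplit : d ^ (2 + e) = d ^ 2 * (d ^ 2) ^ (e / 2) := by
    rw [Real.rpow_add' hd h2e, Real.rpow_two, ← Real.rpow_natCast_mul hd 2 (e / 2)]
    congr 1
    push_cast
    ring_nf
  rw [hsplit]
  exact mul_le_mul_of_nonneg_left (Real.rpow_le_rpow (sq_nonneg d) hM (by positivity)) (sq_nonneg d)

/-- **Termwise value bound.**  If `0 ≤ c`, `0 < P`, `0 ≤ e` and `c · P^{3/2} ≤ V`, then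
`c^{(2+e)/3} · (P · P^{e/2}) ≤ V^{(2+e)/3}`: raise `c P^{3/2} ≤ V` to the power `(2+e)/3`
(`Real.rpow_le_rpow`) and expand the left-hand side (`Real.mul_rpow`, `Real.rpow_mul`,
`Real.rpow_add`). -/
theorem value_term_le {c P V e : ℝ} (hc : 0 ≤ c) (hP : 0 < P) (he : 0 ≤ e)
    (hV : c * P ^ (3 / 2 : ℝ) ≤ V) :
    c ^ ((2 + e) / 3) * (P * P ^ (e / 2)) ≤ V ^ ((2 + e) / 3) := by
  have h0 : 0 ≤ c * P ^ (3 / 2 : ℝ) := by positivity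
  have hpow := Real.rpow_le_rpow h0 hV (by positivity : (0 : ℝ) ≤ (2 + e) / 3)
  have hexp : (c * P ^ (3 / 2 : ℝ)) ^ ((2 + e) / 3) = c ^ ((2 + e) / 3) * (P * P ^ (e / 2)) := by
    rw [Real.mul_rpow hc (by positivity), ← Real.rpow_mul hP.le,
      show (3 / 2 : ℝ) * ((2 + e) / 3) = 1 + e / 2 by ring, Real.rpow_add hP, Real.rpow_one]
  rwa [hexp] at hpow

/-- **Finite power-mean core.**  On a finset `S` with nonnegative "degrees" `d`, wall
`B = Σ_{S} d² > 0`, `t ≥ 1` "volumes" `V i ≥ c (B/t)^{3/2}` (`c > 0`), a ratio `R > 0` with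
`R t d² ≤ B` on `S` and `R^{-ε/2} < c^{(2+ε)/3}` (`ε > 0`):
`Σ_{S} d^{2+ε} < Σ_i (V i)^{(2+ε)/3}`.  Budget via `Finset.sum_le_sum`/`Finset.sum_mul`,
value via `Finset.card_nsmul_le_sum`. [cite: CohnKleinbergSzegedyUmans2005, Thm. 5.5] -/
theorem sum_rpow_lt_sum_volume_rpow {α : Type*} (S : Finset α) (d : α → ℝ) (t : ℕ)
    (V : Fin t → ℝ) {c R B ε : ℝ} (hc : 0 < c) (hε : 0 < ε) (hR : 0 < R)
    (hkey : R ^ (-(ε / 2)) < c ^ ((2 + ε) / 3)) (ht : 1 ≤ t)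
    (hB : ∑ χ ∈ S, d χ ^ 2 = B) (hB0 : 0 < B) (hd : ∀ χ ∈ S, 0 ≤ d χ)
    (hdeg : ∀ χ ∈ S, R * t * d χ ^ 2 ≤ B)
    (hvol : ∀ i : Fin t, c * (B / t) ^ (3 / 2 : ℝ) ≤ V i) :
    ∑ χ ∈ S, d χ ^ (2 + ε) < ∑ i : Fin t, V i ^ ((2 + ε) / 3) := by
  have htpos : (0 : ℝ) < t := Nat.cast_pos.mpr ht
  have hP : 0 < B / t := div_pos hB0 htpos
  -- every square degree is at most `M = (B/t)/R`
  have hM : ∀ χ ∈ S, d χ ^ 2 ≤ B / t / R := fun χ hχ => by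
    rw [div_div, le_div_iff₀' (by positivity)]
    calc (t : ℝ) * R * d χ ^ 2 = R * t * d χ ^ 2 := by ring
      _ ≤ B := hdeg χ hχ
  -- (1) budget `≤ B · M^{ε/2}`
  have hbud : ∑ χ ∈ S, d χ ^ (2 + ε) ≤ B * (B / t / R) ^ (ε / 2) := by
    calc ∑ χ ∈ S, d χ ^ (2 + ε) ≤ ∑ χ ∈ S, d χ ^ 2 * (B / t / R) ^ (ε / 2) :=
          Finset.sum_le_sum fun χ hχ => rpow_two_add_le (hd χ hχ) (hM χ hχ) hε.le
      _ = B * (B / t / R) ^ (ε / 2) := by rw [← Finset.sum_mul, hB]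
  -- (2) value `≥ t · c^{(2+ε)/3} · (B/t)^{1+ε/2}`
  have hval : (t : ℝ) * (c ^ ((2 + ε) / 3) * (B / t * (B / t) ^ (ε / 2))) ≤
      ∑ i : Fin t, V i ^ ((2 + ε) / 3) := by
    have h := Finset.card_nsmul_le_sum Finset.univ (fun i : Fin t => V i ^ ((2 + ε) / 3))
      (c ^ ((2 + ε) / 3) * (B / t * (B / t) ^ (ε / 2)))
      fun i _ => value_term_le hc.le hP hε.le (hvol i)
    rwa [Finset.card_univ, Fintype.card_fin, nsmul_eq_mul] at h
  -- (3) comparison: both sides are `B (B/t)^{ε/2}` times `R^{-ε/2}` resp. `c^{(2+ε)/3}`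
  have hMpow : (B / t / R) ^ (ε / 2) = (B / t) ^ (ε / 2) * R ^ (-(ε / 2)) := by
    rw [Real.div_rpow hP.le hR.le, Real.rpow_neg hR.le, div_eq_mul_inv]
  have htB : (t : ℝ) * (B / t) = B := mul_div_cancel₀ B htpos.ne'
  have hpos : 0 < B * (B / t) ^ (ε / 2) := by positivity
  calc ∑ χ ∈ S, d χ ^ (2 + ε) ≤ B * (B / t / R) ^ (ε / 2) := hbud
    _ = B * (B / t) ^ (ε / 2) * R ^ (-(ε / 2)) := by rw [hMpow, mul_assoc]
    _ < B * (B / t) ^ (ε / 2) * c ^ ((2 + ε) / 3) := mul_lt_mul_of_pos_left hkey hpos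
    _ = (t : ℝ) * (c ^ ((2 + ε) / 3) * (B / t * (B / t) ^ (ε / 2))) := by
        linear_combination (-(c ^ ((2 + ε) / 3) * (B / t) ^ (ε / 2))) * htB
    _ ≤ ∑ i : Fin t, V i ^ ((2 + ε) / 3) := hval

/-- **`stub_shareUniversality` — splitting the wall among `t` pieces is free** (registered stub of
crux `stmt-MatrixMultiplication-7610`, verbatim signature).  Shared-wall families with a fixed
filling fraction `c > 0` (for every ratio `R`: a finite host `G`, a bi-invariant `J ≤ ℂ^G`,
`t ≥ 1` simultaneously `J`-separated pieces of volume `≥ c (B₂/t)^{3/2}` each, wall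
`B₂ = Σ_{Irr G ∩ J} χ(1)² > 0`, and `R t χ(1)² ≤ B₂` on `Irr G ∩ J`) contain, for every `ε > 0`, a
graded simultaneous design at exponent `2 + ε`.  Proof: pick `R` by `eventually_ratio`
(`Filter.Eventually.exists`), take that member of the family, turn the `finsum` into a `Finset.sum`
over the finite set `Irr G ∩ J` (`irrChars_finite_holds`), note that every degree `χ(1)` is a
natural number (`IsIrrChar.exists_apply_one`), hence `≥ 0`, and apply
`sum_rpow_lt_sum_volume_rpow`.
[cite: CohnKleinbergSzegedyUmans2005, Thm. 5.5] -/
theorem stub_shareUniversality (c : ℝ) (hc : 0 < c)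
    (hfam : ∀ R : ℝ, ∃ (G : Type) (_ : Group G) (_ : Fintype G) (J : Submodule ℂ (G → ℂ))
      (B₂ : ℝ) (t : ℕ) (X Y Z : Fin t → Finset G),
      B₂ = (∑ᶠ χ ∈ Literature.RepresentationTheory.FiniteGroups.irrChars G ∩ (J : Set (G → ℂ)),
        (χ 1).re ^ (2 : ℝ)) ∧
      (∀ f ∈ J, ∀ a b : G, (fun g : G => f (a * g * b)) ∈ J) ∧
      (∀ i : Fin t, ∀ x₀ ∈ X i, ∀ z₀ ∈ Z i, ∃ f ∈ J, ∀ j k : Fin t,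
        ∀ x ∈ X j, ∀ y ∈ Y j, ∀ y' ∈ Y k, ∀ z ∈ Z k,
          ((j = i ∧ k = i ∧ x = x₀ ∧ y = y' ∧ z = z₀) → f (x⁻¹ * y * y'⁻¹ * z) = 1) ∧
          (¬ (j = i ∧ k = i ∧ x = x₀ ∧ y = y' ∧ z = z₀) → f (x⁻¹ * y * y'⁻¹ * z) = 0)) ∧
      1 ≤ t ∧ 0 < B₂ ∧
      (∀ i, c * (B₂ / t) ^ (3 / 2 : ℝ) ≤ ((((X i).card * (Y i).card * (Z i).card : ℕ) : ℝ))) ∧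
      (∀ χ ∈ Literature.RepresentationTheory.FiniteGroups.irrChars G ∩ (J : Set (G → ℂ)),
        R * t * (χ 1).re ^ 2 ≤ B₂))
    (ε : ℝ) (hε : 0 < ε) :
    ∃ (H : Type) (_ : Group H) (_ : Fintype H) (J : Submodule ℂ (H → ℂ)) (n : ℕ)
      (X Y Z : Fin n → Finset H),
      (∀ f ∈ J, ∀ a b : H, (fun g : H => f (a * g * b)) ∈ J) ∧
      (∀ i : Fin n, ∀ x₀ ∈ X i, ∀ z₀ ∈ Z i, ∃ f ∈ J, ∀ j k : Fin n,
        ∀ x ∈ X j, ∀ y ∈ Y j, ∀ y' ∈ Y k, ∀ z ∈ Z k,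
          ((j = i ∧ k = i ∧ x = x₀ ∧ y = y' ∧ z = z₀) → f (x⁻¹ * y * y'⁻¹ * z) = 1) ∧
          (¬ (j = i ∧ k = i ∧ x = x₀ ∧ y = y' ∧ z = z₀) → f (x⁻¹ * y * y'⁻¹ * z) = 0)) ∧
      (∑ᶠ χ ∈ Literature.RepresentationTheory.FiniteGroups.irrChars H ∩ (J : Set (H → ℂ)),
        (χ 1).re ^ (2 + ε)) <
        ∑ i, ((((X i).card * (Y i).card * (Z i).card : ℕ) : ℝ) ^ ((2 + ε) / 3)) := by
  obtain ⟨R, hR, hkey⟩ := (eventually_ratio hc hε).exists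
  obtain ⟨G, _instG, _instF, J, B₂, t, X, Y, Z, hB, hJ, hsep, ht, hB0, hvol, hdeg⟩ := hfam R
  refine ⟨G, inferInstance, inferInstance, J, t, X, Y, Z, hJ, hsep, ?_⟩
  -- the visible irreducible characters form a finite set: the `finsum`s are `Finset.sum`s
  have hfin : (irrChars G ∩ (J : Set (G → ℂ))).Finite :=
    (irrChars_finite_holds G).subset Set.inter_subset_left
  rw [finsum_mem_eq_finite_toFinset_sum _ hfin] at hB ⊢
  have hB' : ∑ χ ∈ hfin.toFinset, (χ 1).re ^ 2 = B₂ := by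
    rw [hB]
    exact Finset.sum_congr rfl fun χ _ => (Real.rpow_two _).symm
  exact sum_rpow_lt_sum_volume_rpow hfin.toFinset (fun χ => (χ 1).re) t
    (fun i => (((X i).card * (Y i).card * (Z i).card : ℕ) : ℝ)) hc hε hR hkey ht hB' hB0
    (fun χ hχ => by
      -- the degree `χ(1)` of an irreducible character is a natural number
      obtain ⟨m, -, hm⟩ := IsIrrChar.exists_apply_one (hfin.mem_toFinset.mp hχ).1
      rw [hm, Complex.natCast_re]
      exact m.cast_nonneg)
    (fun χ hχ => hdeg χ (hfin.mem_toFinset.mp hχ)) hvol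

end Summit.MatrixMultiplication.MatrixMultiplication.Theorems.GradedDesignFamily.MathlibRoute

end
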